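import Literature.Geometry.Hyperkaehler.HyperkaehlerManifold
import Literature.Geometry.Kaehler.ApproxHermitianYangMills
import HarnessLib

/-!
# Hyperholomorphic connections and bundles over a hyperkähler manifold

Definition item `defn-IsHyperholomorphic` (topic `Literature/Geometry/Hyperkaehler`; wanted by the
Hodge-conjecture twistor-transport lines — `EvenB2Twistor` crux `HyperholomorphicTransport`
(stmt-HodgeConjecture-3274), `NikulinTwinSimilitude`, `OG6CharacterSectors` — as the notion against
which Verbitsky's theorems are to be stated as named facts).

## Source (read: Verbitsky, *Hyperholomorphic bundles over a hyperkähler manifold*, alg-geom/9307008 =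
J. Alg. Geom. 5 (1996); restated in Verbitsky, *Hyperholomorphic sheaves …*, alg-geom/9712012 §2.4, §3.3)

* Def. 1.2: on a hyperkähler manifold `(M, I, J, K)` the **induced complex structures** are
  `L = aI + bJ + cK`, `a² + b² + c² = 1` (the tree's `inducedJ J K a b c`,
  `IsHyperkaehlerTriple.inducedJ_inducedJ : L² = −1`). §1: `I, J, K` make `TM` a module over the
  quaternions `ℍ`; the unit quaternions act on `TM` and hence on forms — the group
  `SU(2) = G_M` ("isotropy group") whose Lie algebra is spanned by `ad I, ad J, ad K`.
* Prop. 1.2: a form is `G_M`-invariant iff it is of Hodge type `(p,p)` with respect to ALL induced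
  complex structures.
* Thm. 2.1 (Newlander–Nirenberg for bundles, = Kobayashi I Prop. 4.17 / Prop. 3.7): a Hermitian
  connection is integrable (compatible with a holomorphic structure) iff its curvature `Θ` is of
  type `(1,1)`.
* **Def. 2.1**: "Let `B` be a Hermitian bundle with a Hermitian connection `θ` over a hyperkähler
  manifold `M`. The connection `θ` is called **hyperholomorphic** if it is integrable with respect to
  any complex structure induced by a hyperkähler structure. As follows from Theorem 2.1, `θ` is
  hyperholomorphic if and only if its curvature `Θ` is of type `(1,1)` with respect to any of complex
  structures induced by a hyperkähler structure. As follows from Proposition 1.2, `θ` is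
  hyperholomorphic if and only if `Θ` is a `G_M`-invariant differential form." The last form is the
  one Verbitsky works with (proof of Thm. 2.3: "We will use the definition of a hyperholomorphic
  connection as one with `G_M`-invariant curvature"; alg-geom/9712012 §3.3: "`∇` is called
  hyperholomorphic if its curvature … is `SU(2)`-invariant").
* Def. 2.4: a stable holomorphic bundle `B` on `(M, I)` is (simple) hyperholomorphic if its unique
  Yang–Mills connection (Uhlenbeck–Yau, Thm. 2.2) is hyperholomorphic; by Thm. 2.3 (a hyperholomorphic
  connection is Yang–Mills with `Λ Θ = 0`) this is "`B` carries a hyperholomorphic connection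
  compatible with its holomorphic structure".

## Lean rendering

Everything is reduced to ONE piece of pointwise linear algebra, stated for a `2`-covector `β` on the
real tangent space `T_x M` with values in any real normed space `W` (`W = ℂ` for the entries of a
curvature MATRIX, `W = End F` for operator-valued curvature forms):

* `IsSU2InvariantAt J K x β`: **for every `(a, b, c) ∈ S²`, `β(Lv, Lw) = β(v, w)` with
  `L = aI + bJ + cK`** — i.e. `β` is of type `(1,1)` with respect to every induced complex structure:
  for a `2`-form and an almost complex structure `L`, the pull-back `L^*` acts on `Λ^{p,q}_L` by
  `i^{p−q}`, so `Λ^{1,1}_L` is exactly the fixed space of `L^*` on `Λ²_ℂ ⊗ W` (the characterisation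
  the tree already uses for `I`: `MForm.oneOnePart`, `HermitianHolomorphicBundle.pullbackJ_curvatureForm`;
  Voisin I, Lemma 3.3). This is the middle one of Verbitsky's three equivalent formulations, the one
  that needs neither the Newlander–Nirenberg theorem nor the integration of `𝔰𝔲(2)` to a group action.
* PROVED here (pure quaternion algebra, from the relations packaged in `IsHyperkaehlerTriple`):
  `isSU2InvariantAt_iff` — it suffices to check `L = I` and `L = J`;
  `isSU2InvariantAt_iff_quaternion` — equivalently `β(qv, qw) = β(v, w)` for every UNIT QUATERNION
  `q = q₀ + q₁I + q₂J + q₃K` (`quaternionAct`), i.e. `β` is invariant under the group `SU(2) = Sp(1)`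
  of unit quaternions acting on `T_x M` — Verbitsky's "`G_M`-invariant" (Prop. 1.2 in degree `2`);
  `IsSU2InvariantAt.apply_tangentRotate` — in particular `β(e^{iθ}v, e^{iθ}w) = β(v, w)`, the pointwise
  content of the tree's `IsOfType 1 1` for the given complex structure `I`.
* `IsSU2InvariantOn J K β U`: the pointwise condition at every point of `U ⊆ M` for a `W`-valued
  `2`-form `β` (curvature forms are only meaningful on frame domains).

The curvature condition is then attached, by dot notation, to the three kinds of
connections-with-curvature the layer `Literature/Geometry/Kaehler` has:

* `SmoothComplexVectorBundle.Connection.IsAutodual D J K` — cocycle-presented `C^∞` bundle `V` of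
  rank `r` (`ComplexVectorBundle.lean`, the carrier of `IsSlopeStable` and of the Chern character),
  connection matrices `ω_i`, curvature matrices `Ω_i = dω_i + ω_i ∧ ω_i` on `U_i`: every entry of every
  `Ω_i` is `SU(2)`-invariant on `U_i` (frame changes conjugate `Ω`, Kobayashi I.(1.17), so the
  condition does not depend on the frames). The cocycle layer carries no Hermitian metrics and its
  connections are arbitrary, and for a NOT NECESSARILY HERMITIAN connection "curvature in
  `Λ²_inv(M, End B)`" is, verbatim, Kaledin–Verbitsky's **autodual connection** — "a non-Hermitian
  analogue of the notion of a hyperholomorphic connection" (alg-geom/9712012 §7.1, after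
  Kaledin–Verbitsky, *Non-Hermitian Yang–Mills connections*), the hypothesis of their twistor
  transform; a hyperholomorphic connection is a Hermitian autodual one.
* `UnitaryConnection.IsHyperholomorphic D J K` — VERBATIM Def. 2.1: a Hermitian bundle `(V, h)`
  (`HermitianStructure`) with a Hermitian (= unitary) connection `D` (`UnitaryConnection`,
  `ApproxHermitianYangMills.lean`), whose curvature `Ω_{x₀} = dθ + θ ∧ θ` in every frame of the atlas is
  `SU(2)`-invariant on the frame domain.
* `HermitianHolomorphicBundle.IsHyperholomorphic hB J K` — the Chern connection of a Hermitian
  HOLOMORPHIC bundle `(V, h)` on `(M, I)` (`HermitianHolomorphicBundle.lean`; the unique `h`-unitary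
  connection compatible with the holomorphic structure, Kobayashi I.(4.9)) has `SU(2)`-invariant
  curvature; since that curvature is of type `(1,1)` for `I` by construction, this is `J`-invariance
  alone (`HermitianHolomorphicBundle.isHyperholomorphic_iff`). And
  `HasHyperholomorphicConnection F V J K`: the holomorphic bundle `V` admits a Hermitian metric whose
  Chern connection is hyperholomorphic, i.e. "`B` carries a (Hermitian) hyperholomorphic connection
  compatible with its holomorphic structure" — for a stable `B` this is Verbitsky's Def. 2.4 by his
  Thms. 2.2–2.3, and in general it is his "direct sum of stable hyperholomorphic bundles" by
  Thm. 2.3 + Uhlenbeck–Yau/Kobayashi–Lübke (neither re-proved here: the equivalence is a theorem to be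
  cited, not folded into the definition).

The hyperkähler structure enters only through the endomorphism fields `J, K` (with `I = tangentJ E`
the complex structure of `M`), explicit arguments as in `IsHyperkaehlerTriple g J K`; consumers
assume `IsHyperkaehlerTriple g J K` (the metric `g` plays no role in the definition, exactly as in
the source, and compactness is not built in).

Non-vacuity (proved): flat connections — the trivial connection on `M × ℂʳ` (autodual), the trivial
unitary connection and the flat product Hermitian holomorphic bundle `M × F` (hyperholomorphic) —
qualify for every `(J, K)`, while the Kähler form `ω_I` itself is NOT `SU(2)`-invariant
(`not_isSU2InvariantAt_kaehlerForm`, the degree-`2` case of Verbitsky's Lemma 2.1); `SU(2)`-invariant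
covectors form a subspace stable under post-composition with linear maps (so traces and matrix
entries of invariant operator-valued forms are invariant).

## What is NOT here (theorems about the notion, to be vendored as cited facts against it)

Newlander–Nirenberg / Thm. 2.1 (hyperholomorphic ⇒ `∇^{0,1}_L` is a holomorphic structure for every
`L`); Thm. 2.3 (hyperholomorphic ⇒ Yang–Mills, `Λ_L Θ = 0`); Thm. 2.5 (stable with `SU(2)`-invariant
`c₁, c₂` ⇒ hyperholomorphic); the twistor correspondence (Kaledin–Verbitsky) and hyperholomorphic
SHEAVES (alg-geom/9712012 §3); the `SU(2)`-action on higher-degree forms and on cohomology.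

## References

* [Verbitsky1996Hyperholomorphic] M. Verbitsky, Hyperholomorphic bundles over a hyperkähler manifold,
  J. Alg. Geom. 5 (1996) 633–669 = alg-geom/9307008: Def. 1.2, Prop. 1.2, Thm. 2.1, Def. 2.1,
  Thms. 2.2–2.3, Def. 2.4, Thm. 2.5 (read, pp. 1–3 of the arXiv text).
* [Verbitsky1997HyperholomorphicSheaves] M. Verbitsky, Hyperholomorphic sheaves and new examples of
  hyperkähler manifolds, alg-geom/9712012, §2.4, §3.3 and §7.1 (autodual connections) (read).
* D. Kaledin, M. Verbitsky, Non-Hermitian Yang–Mills connections, Selecta Math. (N.S.) 4 (1998)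
  279–320 (the source of §7.1; not read here).
* [Kobayashi1987] S. Kobayashi, Differential Geometry of Complex Vector Bundles, I.(1.12), (1.17),
  Prop. 3.7, Prop. 4.9, Prop. 4.17.
* [Huybrechts2016K3] D. Huybrechts, Lectures on K3 Surfaces, Ch. 7 §3.2 (twistor family `aI + bJ + cK`).
-/

noncomputable section

open scoped Manifold ContDiff Topology
open Bundle Set

namespace Literature.Geometry.Hyperkaehler

open Literature.Geometry.Kaehler
open Literature.NumberTheory.Transcendental (tangentRotate tangentRotate_eq_cos_add_sin_tangentJ)

variable {E : Type*} [NormedAddCommGroup E] [NormedSpace ℂ E]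
  {M : Type*} [TopologicalSpace M] [ChartedSpace E M]
  {W : Type*} [NormedAddCommGroup W] [NormedSpace ℝ W]

/-! ### Bilinearity of `2`-covectors in the `![v, w]` format (auxiliary) -/

section TwoCovector

variable {T : Type*} [AddCommGroup T] [Module ℝ T] [TopologicalSpace T]

/-- `β(v + v', w) = β(v, w) + β(v', w)`. [folklore] -/
theorem apply₂_add_left (β : T [⋀^Fin 2]→L[ℝ] W) (v v' w : T) :
    β ![v + v', w] = β ![v, w] + β ![v', w] :=
  β.toContinuousMultilinearMap.cons_add ![w] v v'

/-- `β(c • v, w) = c • β(v, w)`. [folklore] -/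
theorem apply₂_smul_left (β : T [⋀^Fin 2]→L[ℝ] W) (c : ℝ) (v w : T) :
    β ![c • v, w] = c • β ![v, w] :=
  β.toContinuousMultilinearMap.cons_smul ![w] c v

/-- Antisymmetry: `β(w, v) = −β(v, w)`. [folklore] -/
theorem apply₂_swap (β : T [⋀^Fin 2]→L[ℝ] W) (v w : T) : β ![w, v] = -β ![v, w] := by
  have h := β.map_swap ![v, w] (i := 0) (j := 1) (by decide)
  have hs : (![v, w] : Fin 2 → T) ∘ Equiv.swap 0 1 = ![w, v] := by
    funext i; fin_cases i <;> rfl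
  rwa [hs] at h

/-- `β(v, w + w') = β(v, w) + β(v, w')`. [folklore] -/
theorem apply₂_add_right (β : T [⋀^Fin 2]→L[ℝ] W) (v w w' : T) :
    β ![v, w + w'] = β ![v, w] + β ![v, w'] := by
  rw [apply₂_swap β (w + w') v, apply₂_add_left, neg_add, ← apply₂_swap β w v,
    ← apply₂_swap β w' v]

/-- `β(v, c • w) = c • β(v, w)`. [folklore] -/
theorem apply₂_smul_right (β : T [⋀^Fin 2]→L[ℝ] W) (c : ℝ) (v w : T) :
    β ![v, c • w] = c • β ![v, w] := by
  rw [apply₂_swap β (c • w) v, apply₂_smul_left, ← smul_neg, ← apply₂_swap β w v]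

/-- `β(v, −w) = −β(v, w)`. [folklore] -/
theorem apply₂_neg_right (β : T [⋀^Fin 2]→L[ℝ] W) (v w : T) : β ![v, -w] = -β ![v, w] := by
  rw [← neg_one_smul ℝ w, apply₂_smul_right, neg_one_smul]

/-- `β(−v, w) = −β(v, w)`. [folklore] -/
theorem apply₂_neg_left (β : T [⋀^Fin 2]→L[ℝ] W) (v w : T) : β ![-v, w] = -β ![v, w] := by
  rw [← neg_one_smul ℝ v, apply₂_smul_left, neg_one_smul]

/-- Pull-back of a `2`-covector by a linear map in the `![v, w]` format:
`(A^*β)(v, w) = β(Av, Aw)`. [folklore] -/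
theorem compContinuousLinearMap_apply₂ [ContinuousAdd T] [ContinuousConstSMul ℝ T]
    (β : T [⋀^Fin 2]→L[ℝ] W) (A : T →L[ℝ] T) (v w : T) :
    β.compContinuousLinearMap A ![v, w] = β ![A v, A w] := by
  rw [ContinuousAlternatingMap.compContinuousLinearMap_apply]
  congr 1
  funext i; fin_cases i <;> rfl

end TwoCovector

/-! ### The quaternion action on tangent vectors -/

/-- The action of the quaternion `q = q₀ + q₁ i + q₂ j + q₃ k` on the real tangent space of the
hyperkähler manifold `(M, I, J, K)` at `x`: `v ↦ q₀ v + q₁ Iv + q₂ Jv + q₃ Kv`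
(`= q₀ • id + inducedJ J K q₁ q₂ q₃ x`). The unit quaternions (`q₀² + q₁² + q₂² + q₃² = 1`) form the
group `SU(2) = Sp(1)` — Verbitsky's isotropy group `G_M` — and the pure unit quaternions (`q₀ = 0`)
are the induced complex structures (Def. 1.2). [cite: Verbitsky1996Hyperholomorphic, §1 and Def. 1.2] -/
def quaternionAct (J K : ∀ x : M, TangentSpace 𝓘(ℝ, E) x →L[ℝ] TangentSpace 𝓘(ℝ, E) x)
    (q₀ q₁ q₂ q₃ : ℝ) (x : M) : TangentSpace 𝓘(ℝ, E) x →L[ℝ] TangentSpace 𝓘(ℝ, E) x :=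
  q₀ • ContinuousLinearMap.id ℝ (TangentSpace 𝓘(ℝ, E) x) + inducedJ J K q₁ q₂ q₃ x

/-- `q · v = q₀ v + q₁ Iv + q₂ Jv + q₃ Kv`. [cite: Verbitsky1996Hyperholomorphic, §1] -/
theorem quaternionAct_apply (J K : ∀ x : M, TangentSpace 𝓘(ℝ, E) x →L[ℝ] TangentSpace 𝓘(ℝ, E) x)
    (q₀ q₁ q₂ q₃ : ℝ) (x : M) (v : TangentSpace 𝓘(ℝ, E) x) :
    quaternionAct J K q₀ q₁ q₂ q₃ x v =
      q₀ • v + q₁ • tangentJ E x v + q₂ • J x v + q₃ • K x v := by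
  change q₀ • v + inducedJ J K q₁ q₂ q₃ x v = _
  rw [inducedJ_apply]
  abel

/-- A pure quaternion acts as the induced endomorphism `aI + bJ + cK`.
[cite: Verbitsky1996Hyperholomorphic, Def. 1.2] -/
@[simp]
theorem quaternionAct_zero (J K : ∀ x : M, TangentSpace 𝓘(ℝ, E) x →L[ℝ] TangentSpace 𝓘(ℝ, E) x)
    (a b c : ℝ) (x : M) : quaternionAct J K 0 a b c x = inducedJ J K a b c x := by
  simp [quaternionAct]

/-! ### `SU(2)`-invariant `2`-covectors -/

/-- **`β` is `SU(2)`-invariant** (Verbitsky: `G_M`-invariant) — a `W`-valued `2`-covector `β` on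
the real tangent space at `x` of the hyperkähler manifold `(M, I = tangentJ E, J, K)` is **of type
`(1,1)` with respect to every induced complex structure** `L = aI + bJ + cK`, `(a, b, c) ∈ S²`:
`β(Lv, Lw) = β(v, w)` for all `v, w` (for `2`-forms, `Λ^{1,1}_L` is the fixed space of `L^*`, which
acts on `Λ^{p,q}_L` by `i^{p−q}`). Equivalent forms proved below: invariance under `I` and `J` alone
(`IsHyperkaehlerTriple.isSU2InvariantAt_iff`); invariance under all unit quaternions, i.e. under the
group `SU(2)` (`IsHyperkaehlerTriple.isSU2InvariantAt_iff_quaternion`, Verbitsky's Prop. 1.2 in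
degree `2`). [cite: Verbitsky1996Hyperholomorphic, Prop. 1.2 and Def. 2.1] -/
def IsSU2InvariantAt (J K : ∀ x : M, TangentSpace 𝓘(ℝ, E) x →L[ℝ] TangentSpace 𝓘(ℝ, E) x) (x : M)
    (β : TangentSpace 𝓘(ℝ, E) x [⋀^Fin 2]→L[ℝ] W) : Prop :=
  ∀ a b c : ℝ, a ^ 2 + b ^ 2 + c ^ 2 = 1 → ∀ v w : TangentSpace 𝓘(ℝ, E) x,
    β ![inducedJ J K a b c x v, inducedJ J K a b c x w] = β ![v, w]

section Pointwise

variable {J K : ∀ x : M, TangentSpace 𝓘(ℝ, E) x →L[ℝ] TangentSpace 𝓘(ℝ, E) x} {x : M}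

/-- In Mathlib's spelling: `β` is `SU(2)`-invariant iff `L^*β = β` (`compContinuousLinearMap`) for
every induced complex structure `L`. [cite: Verbitsky1996Hyperholomorphic, Def. 2.1] -/
theorem isSU2InvariantAt_iff_compContinuousLinearMap (β : TangentSpace 𝓘(ℝ, E) x [⋀^Fin 2]→L[ℝ] W) :
    IsSU2InvariantAt J K x β ↔ ∀ a b c : ℝ, a ^ 2 + b ^ 2 + c ^ 2 = 1 →
      β.compContinuousLinearMap (inducedJ J K a b c x) = β := by
  refine forall₄_congr fun a b c _ ↦ ⟨fun h ↦ ?_, fun h v w ↦ ?_⟩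
  · ext u
    have hu : u = ![u 0, u 1] := by funext i; fin_cases i <;> rfl
    rw [hu, compContinuousLinearMap_apply₂, h]
  · rw [← compContinuousLinearMap_apply₂, h]

/-- The zero covector is invariant. [folklore] -/
theorem isSU2InvariantAt_zero (J K : ∀ x : M, TangentSpace 𝓘(ℝ, E) x →L[ℝ] TangentSpace 𝓘(ℝ, E) x)
    (x : M) : IsSU2InvariantAt J K x (0 : TangentSpace 𝓘(ℝ, E) x [⋀^Fin 2]→L[ℝ] W) :=
  fun _ _ _ _ _ _ ↦ by simp

namespace IsSU2InvariantAt

/-- Invariant covectors are stable under addition. [folklore] -/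
theorem add {β γ : TangentSpace 𝓘(ℝ, E) x [⋀^Fin 2]→L[ℝ] W} (hβ : IsSU2InvariantAt J K x β)
    (hγ : IsSU2InvariantAt J K x γ) : IsSU2InvariantAt J K x (β + γ) := fun a b c habc v w ↦ by
  simp only [ContinuousAlternatingMap.add_apply, hβ a b c habc, hγ a b c habc]

/-- Invariant covectors are stable under scalars (real, or complex when `W` is a complex space).
[folklore] -/
theorem smul {S : Type*} [Monoid S] [DistribMulAction S W] [ContinuousConstSMul S W]
    [SMulCommClass ℝ S W] (s : S) {β : TangentSpace 𝓘(ℝ, E) x [⋀^Fin 2]→L[ℝ] W}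
    (hβ : IsSU2InvariantAt J K x β) : IsSU2InvariantAt J K x (s • β) := fun a b c habc v w ↦ by
  simp only [ContinuousAlternatingMap.smul_apply, hβ a b c habc]

/-- Invariant covectors are stable under negation. [folklore] -/
theorem neg {β : TangentSpace 𝓘(ℝ, E) x [⋀^Fin 2]→L[ℝ] W} (hβ : IsSU2InvariantAt J K x β) :
    IsSU2InvariantAt J K x (-β) := fun a b c habc v w ↦ by
  simp only [ContinuousAlternatingMap.neg_apply, hβ a b c habc]

/-- Invariant covectors are stable under subtraction. [folklore] -/
theorem sub {β γ : TangentSpace 𝓘(ℝ, E) x [⋀^Fin 2]→L[ℝ] W} (hβ : IsSU2InvariantAt J K x β)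
    (hγ : IsSU2InvariantAt J K x γ) : IsSU2InvariantAt J K x (β - γ) := fun a b c habc v w ↦ by
  simp only [ContinuousAlternatingMap.sub_apply, hβ a b c habc, hγ a b c habc]

/-- Invariance is preserved by post-composition with a linear map of the values (e.g. matrix
entries, the trace, `A ↦ g A g⁻¹` of an operator-valued form). [folklore] -/
theorem compContinuousLinearMap {W' : Type*} [NormedAddCommGroup W'] [NormedSpace ℝ W']
    (f : W →L[ℝ] W') {β : TangentSpace 𝓘(ℝ, E) x [⋀^Fin 2]→L[ℝ] W} (hβ : IsSU2InvariantAt J K x β) :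
    IsSU2InvariantAt J K x (f.compContinuousAlternatingMap β) := fun a b c habc v w ↦ by
  simp only [ContinuousLinearMap.compContinuousAlternatingMap_coe, Function.comp_apply,
    hβ a b c habc]

/-- An invariant covector is of type `(1,1)` for `I`: `β(Iv, Iw) = β(v, w)` (`L = I`,
`(a, b, c) = (1, 0, 0)`). [cite: Verbitsky1996Hyperholomorphic, Def. 2.1] -/
theorem apply_tangentJ {β : TangentSpace 𝓘(ℝ, E) x [⋀^Fin 2]→L[ℝ] W} (hβ : IsSU2InvariantAt J K x β)
    (v w : TangentSpace 𝓘(ℝ, E) x) : β ![tangentJ E x v, tangentJ E x w] = β ![v, w] := by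
  simpa [inducedJ_apply] using hβ 1 0 0 (by norm_num) v w

/-- An invariant covector is of type `(1,1)` for `J`: `β(Jv, Jw) = β(v, w)`.
[cite: Verbitsky1996Hyperholomorphic, Def. 2.1] -/
theorem apply_J {β : TangentSpace 𝓘(ℝ, E) x [⋀^Fin 2]→L[ℝ] W} (hβ : IsSU2InvariantAt J K x β)
    (v w : TangentSpace 𝓘(ℝ, E) x) : β ![J x v, J x w] = β ![v, w] := by
  simpa [inducedJ_apply] using hβ 0 1 0 (by norm_num) v w

/-- An invariant covector is of type `(1,1)` for `K`: `β(Kv, Kw) = β(v, w)`.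
[cite: Verbitsky1996Hyperholomorphic, Def. 2.1] -/
theorem apply_K {β : TangentSpace 𝓘(ℝ, E) x [⋀^Fin 2]→L[ℝ] W} (hβ : IsSU2InvariantAt J K x β)
    (v w : TangentSpace 𝓘(ℝ, E) x) : β ![K x v, K x w] = β ![v, w] := by
  simpa [inducedJ_apply] using hβ 0 0 1 (by norm_num) v w

end IsSU2InvariantAt

/-! ### The criteria: `I`- and `J`-invariance; invariance under the unit quaternions -/

namespace IsHyperkaehlerTriple

variable {g : RiemannianMetric (fun x : M ↦ TangentSpace 𝓘(ℝ, E) x)}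

/-- **The key computation.** For a hyperkähler triple and a `2`-covector `β` invariant under `I`
and under `J`: `β(Lv, Lw) = (a² + b² + c²) β(v, w)` for `L = aI + bJ + cK` — `β` is then also
`K`-invariant (`K = IJ`), and the six mixed terms cancel in pairs by the quaternion relations
(e.g. `β(Iv, Jw) + β(Jv, Iw) = −β(v, Kw) + β(v, Kw)`). This is the degree-`2` case of
"`𝔤_M = 𝔰𝔲(2)` is generated by `ad I`, `ad J`". [cite: Verbitsky1996Hyperholomorphic, §1 and Prop. 1.2] -/
theorem apply₂_inducedJ (h : IsHyperkaehlerTriple g J K) (x : M)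
    {β : TangentSpace 𝓘(ℝ, E) x [⋀^Fin 2]→L[ℝ] W}
    (hI : ∀ v w : TangentSpace 𝓘(ℝ, E) x, β ![tangentJ E x v, tangentJ E x w] = β ![v, w])
    (hJ : ∀ v w : TangentSpace 𝓘(ℝ, E) x, β ![J x v, J x w] = β ![v, w]) (a b c : ℝ)
    (v w : TangentSpace 𝓘(ℝ, E) x) :
    β ![inducedJ J K a b c x v, inducedJ J K a b c x w] = (a ^ 2 + b ^ 2 + c ^ 2) • β ![v, w] := by
  have hK : ∀ v w, β ![K x v, K x w] = β ![v, w] := fun v w ↦ by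
    rw [← h.I_J, ← h.I_J, hI, hJ]
  -- the six mixed terms
  have mIJ : ∀ v w, β ![tangentJ E x v, J x w] = -β ![v, K x w] := fun v w ↦ by
    have e : J x w = tangentJ E x (-K x w) := by rw [map_neg, h.I_K, neg_neg]
    rw [e, hI, apply₂_neg_right]
  have mJI : ∀ v w, β ![J x v, tangentJ E x w] = β ![v, K x w] := fun v w ↦ by
    have e : tangentJ E x w = J x (K x w) := (h.J_K x w).symm
    rw [e, hJ]
  have mIK : ∀ v w, β ![tangentJ E x v, K x w] = β ![v, J x w] := fun v w ↦ by
    have e : K x w = tangentJ E x (J x w) := (h.I_J x w).symm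
    rw [e, hI]
  have mKI : ∀ v w, β ![K x v, tangentJ E x w] = -β ![v, J x w] := fun v w ↦ by
    have e : tangentJ E x w = K x (-J x w) := by rw [map_neg, h.K_J, neg_neg]
    rw [e, hK, apply₂_neg_right]
  have mJK : ∀ v w, β ![J x v, K x w] = -β ![v, tangentJ E x w] := fun v w ↦ by
    have e : K x w = J x (-tangentJ E x w) := by rw [map_neg, h.J_I, neg_neg]
    rw [e, hJ, apply₂_neg_right]
  have mKJ : ∀ v w, β ![K x v, J x w] = β ![v, tangentJ E x w] := fun v w ↦ by
    have e : J x w = K x (tangentJ E x w) := (h.K_I x w).symm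
    rw [e, hK]
  simp only [inducedJ_apply, apply₂_add_left, apply₂_smul_left, apply₂_add_right,
    apply₂_smul_right, hI, hJ, hK, mIJ, mJI, mIK, mKI, mJK, mKJ, smul_neg]
  module

/-- **Reduction to `I` and `J`**: a `2`-covector is `SU(2)`-invariant iff it is invariant under
`I` and under `J`. [cite: Verbitsky1996Hyperholomorphic, Prop. 1.2] -/
theorem isSU2InvariantAt_iff (h : IsHyperkaehlerTriple g J K) (x : M)
    (β : TangentSpace 𝓘(ℝ, E) x [⋀^Fin 2]→L[ℝ] W) :
    IsSU2InvariantAt J K x β ↔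
      (∀ v w : TangentSpace 𝓘(ℝ, E) x, β ![tangentJ E x v, tangentJ E x w] = β ![v, w]) ∧
        ∀ v w : TangentSpace 𝓘(ℝ, E) x, β ![J x v, J x w] = β ![v, w] :=
  ⟨fun hβ ↦ ⟨hβ.apply_tangentJ, hβ.apply_J⟩, fun ⟨hI, hJ⟩ a b c habc v w ↦ by
    rw [h.apply₂_inducedJ x hI hJ, habc, one_smul]⟩

/-- A `2`-covector invariant under `I` and `J` is `SU(2)`-invariant.
[cite: Verbitsky1996Hyperholomorphic, Prop. 1.2] -/
theorem isSU2InvariantAt_of_apply_tangentJ_of_apply_J (h : IsHyperkaehlerTriple g J K) (x : M)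
    {β : TangentSpace 𝓘(ℝ, E) x [⋀^Fin 2]→L[ℝ] W}
    (hI : ∀ v w : TangentSpace 𝓘(ℝ, E) x, β ![tangentJ E x v, tangentJ E x w] = β ![v, w])
    (hJ : ∀ v w : TangentSpace 𝓘(ℝ, E) x, β ![J x v, J x w] = β ![v, w]) :
    IsSU2InvariantAt J K x β :=
  (h.isSU2InvariantAt_iff x β).2 ⟨hI, hJ⟩

/-- **`SU(2)`-invariance = invariance under the group of unit quaternions** (Verbitsky's
`G_M`-invariance, Prop. 1.2 in degree `2`): `β(qv, qw) = β(v, w)` for all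
`q = q₀ + q₁I + q₂J + q₃K` with `q₀² + q₁² + q₂² + q₃² = 1`. The extra terms `q₀qₘ(β(v, Lw) + β(Lv, w))`
vanish because `β(Lv, w) = −β(v, Lw)` for `L ∈ {I, J, K}` (from `β(Lv, Lw) = β(v, w)` and `L² = −1`).
[cite: Verbitsky1996Hyperholomorphic, Prop. 1.2] -/
theorem isSU2InvariantAt_iff_quaternion (h : IsHyperkaehlerTriple g J K) (x : M)
    (β : TangentSpace 𝓘(ℝ, E) x [⋀^Fin 2]→L[ℝ] W) :
    IsSU2InvariantAt J K x β ↔ ∀ q₀ q₁ q₂ q₃ : ℝ, q₀ ^ 2 + q₁ ^ 2 + q₂ ^ 2 + q₃ ^ 2 = 1 →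
      ∀ v w : TangentSpace 𝓘(ℝ, E) x,
        β ![quaternionAct J K q₀ q₁ q₂ q₃ x v, quaternionAct J K q₀ q₁ q₂ q₃ x w] = β ![v, w] := by
  refine ⟨fun hβ q₀ q₁ q₂ q₃ hq v w ↦ ?_, fun hβ a b c habc v w ↦ ?_⟩
  · have hI := hβ.apply_tangentJ
    have hJ := hβ.apply_J
    have hK := hβ.apply_K
    -- the skew-symmetry of `I, J, K` with respect to `β`
    have sI : ∀ w, β ![tangentJ E x v, w] = -β ![v, tangentJ E x w] := fun w ↦ by
      have e := hI v (tangentJ E x w)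
      rw [tangentJ_tangentJ, apply₂_neg_right] at e
      rw [← e, neg_neg]
    have sJ : ∀ w, β ![J x v, w] = -β ![v, J x w] := fun w ↦ by
      have e := hJ v (J x w)
      rw [h.J_J, apply₂_neg_right] at e
      rw [← e, neg_neg]
    have sK : ∀ w, β ![K x v, w] = -β ![v, K x w] := fun w ↦ by
      have e := hK v (K x w)
      rw [h.K_K, apply₂_neg_right] at e
      rw [← e, neg_neg]
    have hLv : β ![inducedJ J K q₁ q₂ q₃ x v, w] = -β ![v, inducedJ J K q₁ q₂ q₃ x w] := by
      simp only [inducedJ_apply, apply₂_add_left, apply₂_smul_left, apply₂_add_right,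
        apply₂_smul_right, sI, sJ, sK, smul_neg, neg_add]
    simp only [quaternionAct, add_apply, FunLike.coe_smul, Pi.smul_apply,
      ContinuousLinearMap.id_apply, apply₂_add_left, apply₂_smul_left, apply₂_add_right,
      apply₂_smul_right, h.apply₂_inducedJ x hI hJ, hLv]
    have key : q₀ ^ 2 • β ![v, w] + (q₁ ^ 2 + q₂ ^ 2 + q₃ ^ 2) • β ![v, w] = β ![v, w] := by
      rw [← add_smul, ← add_assoc, ← add_assoc, hq, one_smul]
    linear_combination (norm := module) key
  · simpa only [quaternionAct_zero] using hβ 0 a b c (by simpa using habc) v w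

/-- In particular an `SU(2)`-invariant covector is invariant under the rotations `e^{θI} = e^{iθ}`
of the tangent space: `β(e^{iθ}v, e^{iθ}w) = β(v, w)` — the pointwise content of "`β` has type
`(1,1)`" for the complex structure `I` of `M` (`IsOfType 1 1`, weight `p − q = 0`, in
`ComplexForms.lean`). [cite: Verbitsky1996Hyperholomorphic, Prop. 1.2] -/
theorem _root_.Literature.Geometry.Hyperkaehler.IsSU2InvariantAt.apply_tangentRotate
    (h : IsHyperkaehlerTriple g J K) {x : M} {β : TangentSpace 𝓘(ℝ, E) x [⋀^Fin 2]→L[ℝ] W}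
    (hβ : IsSU2InvariantAt J K x β) (θ : ℝ) (v w : TangentSpace 𝓘(ℝ, E) x) :
    β ![tangentRotate E x θ v, tangentRotate E x θ w] = β ![v, w] := by
  have hq := (h.isSU2InvariantAt_iff_quaternion x β).1 hβ (Real.cos θ) (Real.sin θ) 0 0
    (by nlinarith [Real.cos_sq_add_sin_sq θ]) v w
  simpa only [quaternionAct_apply, tangentRotate_eq_cos_add_sin_tangentJ, zero_smul, add_zero]
    using hq

/-- **The Kähler form `ω_I` is not `SU(2)`-invariant** (at a point with a non-zero tangent
vector): `ω_I(Jv, Jw) = −ω_I(v, w)`, so invariance would force `g(v, v) = ω_I(v, Iv) = 0`. This is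
the degree-`2` instance of "no section of `R = ⟨ω_L⟩` is `G_M`-invariant" in the proof of Verbitsky's
Lemma 2.1 (the `ω_L` span the complement of the invariant `2`-forms), and shows that the predicate
is a genuine restriction. [cite: Verbitsky1996Hyperholomorphic, Lemma 2.1] -/
theorem not_isSU2InvariantAt_kaehlerForm (h : IsHyperkaehlerTriple g J K) (x : M)
    (hx : ∃ v : TangentSpace 𝓘(ℝ, E) x, v ≠ 0) : ¬ IsSU2InvariantAt J K x (g.kaehlerForm x) := by
  rintro hβ
  obtain ⟨v, hv⟩ := hx
  have h1 := hβ.apply_J v (tangentJ E x v)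
  rw [g.kaehlerForm_apply_of_isHermitian h.isHermitian,
    g.kaehlerForm_apply_of_isHermitian h.isHermitian, h.I_J, h.J_I, map_neg, h.inner_K,
    h.isHermitian] at h1
  have h2 := g.pos x v hv
  linarith

end IsHyperkaehlerTriple

end Pointwise

/-! ### `SU(2)`-invariant `2`-forms on a set -/

/-- The `W`-valued `2`-form `β` is `SU(2)`-invariant (of type `(1,1)` for every induced complex
structure) at every point of `U ⊆ M`: `β|_U ∈ Λ²_inv(U) ⊗ W` (curvature forms in a frame are only
meaningful on the frame's domain, whence the set). [cite: Verbitsky1996Hyperholomorphic, Def. 2.1] -/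
def IsSU2InvariantOn (J K : ∀ x : M, TangentSpace 𝓘(ℝ, E) x →L[ℝ] TangentSpace 𝓘(ℝ, E) x)
    (β : MForm 𝓘(ℝ, E) M W 2) (U : Set M) : Prop :=
  ∀ x ∈ U, IsSU2InvariantAt J K x (β x)

/-- The zero form is invariant on every set. [folklore] -/
theorem isSU2InvariantOn_zero (J K : ∀ x : M, TangentSpace 𝓘(ℝ, E) x →L[ℝ] TangentSpace 𝓘(ℝ, E) x)
    (U : Set M) : IsSU2InvariantOn J K (0 : MForm 𝓘(ℝ, E) M W 2) U :=
  fun x _ ↦ isSU2InvariantAt_zero J K x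

/-- Invariance on a set is monotone in the set. [folklore] -/
theorem IsSU2InvariantOn.mono {J K : ∀ x : M, TangentSpace 𝓘(ℝ, E) x →L[ℝ] TangentSpace 𝓘(ℝ, E) x}
    {β : MForm 𝓘(ℝ, E) M W 2} {U U' : Set M} (hβ : IsSU2InvariantOn J K β U) (hU : U' ⊆ U) :
    IsSU2InvariantOn J K β U' :=
  fun x hx ↦ hβ x (hU hx)

/-- A form with `I^*β = β` (`MForm.pullbackJ`, e.g. the `(1,1)`-part of any `2`-form, or the
curvature of a Chern connection) is `I`-invariant at every point, in the `![v, w]` format. [folklore] -/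
theorem apply_tangentJ_of_pullbackJ_eq {β : MForm 𝓘(ℝ, E) M W 2} (hβ : β.pullbackJ = β) (x : M)
    (v w : TangentSpace 𝓘(ℝ, E) x) : β x ![tangentJ E x v, tangentJ E x w] = β x ![v, w] := by
  have h := congrArg (fun γ : MForm 𝓘(ℝ, E) M W 2 ↦ γ x ![v, w]) hβ
  simp only [MForm.pullbackJ_apply] at h
  rw [← h]
  congr 1
  funext i; fin_cases i <;> rfl

/-! ### Autodual connections (cocycle-presented bundles) -/

section Cocycle

variable {ι : Type*} {r : ℕ}

/-- **Autodual connection (Kaledin–Verbitsky).** "Let `M` be a hyperkähler manifold, not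
necessarily compact, and `(B, ∇)` be a vector bundle with a connection over `M`, not necessarily
Hermitian. Assume that the curvature of `∇` is contained in the space `Λ²_inv(M, End(B))` of
`SU(2)`-invariant `2`-forms with coefficients in `End(B)`. Then `(B, ∇)` is called an autodual
bundle, and `∇` an autodual connection" — "a non-Hermitian analogue of the notion of a
hyperholomorphic connection" (a hyperholomorphic connection, Verbitsky's Def. 2.1, is a HERMITIAN
autodual connection: `UnitaryConnection.IsHyperholomorphic`). On the tree's cocycle-presented `C^∞`
bundle `V` of rank `r` (connection matrices `ω_i` in the frames `s_i` over `U_i`, arbitrary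
connections, no Hermitian metrics): every entry of the curvature matrix `Ω_i = dω_i + ω_i ∧ ω_i` is
`SU(2)`-invariant — of type `(1,1)` for every induced complex structure `L = aI + bJ + cK` — on
`U_i`, for every `i` (frame changes conjugate `Ω`, Kobayashi I.(1.17), and invariance is stable
under linear maps of the values, so this does not depend on the presentation).
[cite: Verbitsky1997HyperholomorphicSheaves, §7.1] -/
def _root_.Literature.Geometry.Kaehler.SmoothComplexVectorBundle.Connection.IsAutodual
    {V : SmoothComplexVectorBundle ι E M r} (D : V.Connection)
    (J K : ∀ x : M, TangentSpace 𝓘(ℝ, E) x →L[ℝ] TangentSpace 𝓘(ℝ, E) x) : Prop :=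
  ∀ (i : ι) (a b : Fin r), IsSU2InvariantOn J K (D.curvature i a b) (V.baseSet i)

/-- The trivial connection on `M × ℂʳ` is autodual (it is flat) — for every `(J, K)`.
[cite: Verbitsky1997HyperholomorphicSheaves, §7.1] -/
theorem _root_.Literature.Geometry.Kaehler.SmoothComplexVectorBundle.Connection.trivial_isAutodual
    (J K : ∀ x : M, TangentSpace 𝓘(ℝ, E) x →L[ℝ] TangentSpace 𝓘(ℝ, E) x) :
    (SmoothComplexVectorBundle.Connection.trivial E M r).IsAutodual J K :=
  fun i a b x _ ↦ by
    rw [SmoothComplexVectorBundle.Connection.curvature_trivial]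
    exact isSU2InvariantAt_zero J K x

/-- An autodual connection has curvature of type `(1,1)` for the complex structure `I` of `M` on
every `U_i`: `Ω_i(Iv, Iw) = Ω_i(v, w)` (the case `L = I`; by the Newlander–Nirenberg theorem for
not necessarily Hermitian connections, alg-geom/9712012 §2.4, `∇^{0,1}_L` is then a holomorphic
structure for every `L` — not re-proved). [cite: Verbitsky1997HyperholomorphicSheaves, §7.1] -/
theorem _root_.Literature.Geometry.Kaehler.SmoothComplexVectorBundle.Connection.IsAutodual.apply_tangentJ
    {V : SmoothComplexVectorBundle ι E M r} {D : V.Connection}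
    {J K : ∀ x : M, TangentSpace 𝓘(ℝ, E) x →L[ℝ] TangentSpace 𝓘(ℝ, E) x}
    (hD : D.IsAutodual J K) (i : ι) (a b : Fin r) {x : M} (hx : x ∈ V.baseSet i)
    (v w : TangentSpace 𝓘(ℝ, E) x) :
    D.curvature i a b x ![tangentJ E x v, tangentJ E x w] = D.curvature i a b x ![v, w] :=
  (hD i a b x hx).apply_tangentJ v w

end Cocycle

/-! ### Hyperholomorphic connections (Hermitian carriers) -/

section Hermitian

variable {F : Type*} [NormedAddCommGroup F] [InnerProductSpace ℂ F] [FiniteDimensional ℂ F]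
  {V : M → Type*} [TopologicalSpace (TotalSpace F V)] [∀ x, TopologicalSpace (V x)]
  [∀ x, AddCommGroup (V x)] [∀ x, Module ℂ (V x)] [FiberBundle F V] [VectorBundle ℂ F V]

/-- **Hyperholomorphic connection (Verbitsky, Def. 2.1).** A Hermitian (= unitary) connection `D`
on the Hermitian vector bundle `(V, h)` over the hyperkähler manifold `(M, I, J, K)` is
hyperholomorphic if its curvature `Ω_{x₀} = dθ_{x₀} + θ_{x₀} ∧ θ_{x₀}` (an `End F`-valued `2`-form, in
the frame of the atlas at `x₀`) is `SU(2)`-invariant — of type `(1,1)` with respect to every induced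
complex structure `L = aI + bJ + cK` — on the frame domain, for every `x₀` (i.e. `D` is a Hermitian
AUTODUAL connection). By Newlander–Nirenberg (Verbitsky's Thm. 2.1) this is his wording "integrable
with respect to any complex structure induced by the hyperkähler structure"; by his Prop. 1.2 it is
"`Θ` is `G_M`-invariant" (`IsHyperkaehlerTriple.isSU2InvariantAt_iff_quaternion`).
[cite: Verbitsky1996Hyperholomorphic, Def. 2.1] -/
def _root_.Literature.Geometry.Kaehler.UnitaryConnection.IsHyperholomorphic {h : HermitianStructure V}
    (D : UnitaryConnection E F h)
    (J K : ∀ x : M, TangentSpace 𝓘(ℝ, E) x →L[ℝ] TangentSpace 𝓘(ℝ, E) x) : Prop :=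
  ∀ x₀ : M, IsSU2InvariantOn J K (D.curvature x₀) (trivializationAt F V x₀).baseSet

/-- The trivial unitary connection on `M × F` is hyperholomorphic (it is flat).
[cite: Verbitsky1996Hyperholomorphic, Def. 2.1] -/
theorem _root_.Literature.Geometry.Kaehler.UnitaryConnection.trivial_isHyperholomorphic
    (J K : ∀ x : M, TangentSpace 𝓘(ℝ, E) x →L[ℝ] TangentSpace 𝓘(ℝ, E) x) :
    (UnitaryConnection.trivial E M F).IsHyperholomorphic J K :=
  fun x₀ x _ ↦ by
    rw [UnitaryConnection.trivial_curvature]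
    exact isSU2InvariantAt_zero J K x

variable [IsManifold 𝓘(ℂ, E) ω M] [ContMDiffVectorBundle ω F V 𝓘(ℂ, E)]

/-- **The Chern connection of the Hermitian holomorphic bundle `(V, h)` on `(M, I)` is
hyperholomorphic**: its curvature `Ω = (dθ)^{1,1}` in every holomorphic frame of the atlas
(`HermitianHolomorphicBundle.curvatureForm`) is `SU(2)`-invariant on the frame domain. The Chern
connection is the unique `h`-unitary connection compatible with the holomorphic structure
(Kobayashi I.(4.9)), so this says: the holomorphic bundle `V` with the metric `h` carries a
hyperholomorphic connection inducing its holomorphic structure.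
[cite: Verbitsky1996Hyperholomorphic, Def. 2.1 and Def. 2.4] -/
def _root_.Literature.Geometry.Kaehler.HermitianHolomorphicBundle.IsHyperholomorphic
    (hB : HermitianHolomorphicBundle E F V)
    (J K : ∀ x : M, TangentSpace 𝓘(ℝ, E) x →L[ℝ] TangentSpace 𝓘(ℝ, E) x) : Prop :=
  ∀ x₀ : M, IsSU2InvariantOn J K (hB.curvatureForm x₀) (trivializationAt F V x₀).baseSet

/-- For the Chern connection, whose curvature is of type `(1,1)` for `I` by construction
(`pullbackJ_curvatureForm`), hyperholomorphy is `J`-invariance of the curvature alone: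
`Ω(Jv, Jw) = Ω(v, w)` on the frame domains. [cite: Verbitsky1996Hyperholomorphic, Def. 2.1] -/
theorem _root_.Literature.Geometry.Kaehler.HermitianHolomorphicBundle.isHyperholomorphic_iff
    {g : RiemannianMetric (fun x : M ↦ TangentSpace 𝓘(ℝ, E) x)}
    {J K : ∀ x : M, TangentSpace 𝓘(ℝ, E) x →L[ℝ] TangentSpace 𝓘(ℝ, E) x}
    (h : IsHyperkaehlerTriple g J K) (hB : HermitianHolomorphicBundle E F V) :
    hB.IsHyperholomorphic J K ↔ ∀ x₀ : M, ∀ x ∈ (trivializationAt F V x₀).baseSet,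
      ∀ v w : TangentSpace 𝓘(ℝ, E) x,
        hB.curvatureForm x₀ x ![J x v, J x w] = hB.curvatureForm x₀ x ![v, w] :=
  ⟨fun H x₀ x hx v w ↦ (H x₀ x hx).apply_J v w, fun H x₀ x hx ↦
    h.isSU2InvariantAt_of_apply_tangentJ_of_apply_J x
      (apply_tangentJ_of_pullbackJ_eq (hB.pullbackJ_curvatureForm x₀) x) (H x₀ x hx)⟩

/-- The flat product structure on `M × F` has a hyperholomorphic Chern connection.
[cite: Verbitsky1996Hyperholomorphic, Def. 2.1] -/
theorem _root_.Literature.Geometry.Kaehler.HermitianHolomorphicBundle.trivial_isHyperholomorphic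
    (J K : ∀ x : M, TangentSpace 𝓘(ℝ, E) x →L[ℝ] TangentSpace 𝓘(ℝ, E) x) :
    (HermitianHolomorphicBundle.trivial E M F).IsHyperholomorphic J K :=
  fun x₀ x _ ↦ by
    rw [HermitianHolomorphicBundle.trivial_curvatureForm]
    exact isSU2InvariantAt_zero J K x

variable (F V) in
/-- **The holomorphic bundle `V` on `(M, I)` carries a hyperholomorphic connection**: there is a
Hermitian metric `h` on `V` whose Chern connection (the unique unitary connection inducing the
holomorphic structure of `V`) is hyperholomorphic. For a STABLE `V` this is Verbitsky's
"hyperholomorphic bundle" (Def. 2.4: the Yang–Mills connection is hyperholomorphic) by his Thm. 2.3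
(hyperholomorphic ⇒ Yang–Mills) and the uniqueness in Uhlenbeck–Yau (Thm. 2.2); in general it is his
"direct sum of stable hyperholomorphic bundles" by the same theorems and Kobayashi–Lübke — theorems
about the notion, cited, not built into it. [cite: Verbitsky1996Hyperholomorphic, Def. 2.4 and Thm. 2.3] -/
def HasHyperholomorphicConnection
    (J K : ∀ x : M, TangentSpace 𝓘(ℝ, E) x →L[ℝ] TangentSpace 𝓘(ℝ, E) x) : Prop :=
  ∃ hB : HermitianHolomorphicBundle E F V, hB.IsHyperholomorphic J K

/-- The product bundle `M × F` carries a hyperholomorphic connection (the flat one).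
[cite: Verbitsky1996Hyperholomorphic, Def. 2.4] -/
theorem hasHyperholomorphicConnection_trivial
    (J K : ∀ x : M, TangentSpace 𝓘(ℝ, E) x →L[ℝ] TangentSpace 𝓘(ℝ, E) x) :
    HasHyperholomorphicConnection F (Bundle.Trivial M F) J K :=
  ⟨HermitianHolomorphicBundle.trivial E M F,
    HermitianHolomorphicBundle.trivial_isHyperholomorphic J K⟩

end Hermitian

end Literature.Geometry.Hyperkaehler

end
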